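import Mathlib
import HarnessLib
import Summits.HubbardSuperconductivity.HubbardSuperconductivity.Theorems.KLProgrammeMatsubaraZeroSound
import Summits.HubbardSuperconductivity.HubbardSuperconductivity.Theorems.KLProgrammeMatsubaraSliceBubbleSignBlind

/-!
# Route `KLProgramme` — crux K3, ENGINE child (`KLRegimeEngineV14`, stmt-HubbardSuperconductivity-19918), stub `stub_engine_step_values`
# (E2-v9) (m)/(neg), (E2″) gains: the SHARP sign-blind mass of a radial profile — exact polar evaluation in the `(k₀, e)` plane
# (cell gate-hubbard-kl, seat hubbard-kl-k3c2-p2 «thermal-bar induction n ≤ nScales β + 1»)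

The sign-blind single-slice bubble masses of the (E2-v9) rung lines ((m) `Σ|w| ≤ bhi`, the harder/softer partner rungs, the
plain↔Wick transfer weight; HOME/hubbard-kl-k3c2-p2/TRANSFER-NOTE.md, `…RungCutoffAlgebra`) are Matsubara sums of `e`-integrals of
a RADIAL profile `N(k₀² + e²)` (`N = ‖f·f′‖/s` for two shell weights) against the ray insertion (Jacobian × vertex weight, `≤ B_W`).
`…SliceBubbleSignBlind` (`klsb2_*`) bounds them by sup × box (`(256/π)·M_f·B_W·A′·Λ_n`); p1 g7's `kled_mass_le_card_mul_card` by a count.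
Here the `(k₀, e)`-integral is evaluated EXACTLY in polar coordinates — `∫∫ N(k₀²+e²) dk₀ de = π·∫_{s>0} N(s) ds` — and the Matsubara
sum is compared with it by the midpoint rule (`klmr_*`), so that per ray
`β⁻¹ Σ_i ∫ ‖W(e)‖·N(ω_i² + e²) de ≤ B_W·(½∫_{s>0} N + 4r²L·(r + 2π/β)/β)` (`N` `L`-Lipschitz, `= 0` for `s ≥ r²`): the scale-free
`ds/s`-masses of `…RungCutoffAlgebra` (`log 64`, `¼ log 4`, `½ log 4`) times `B_W/2`, plus the thermal profile `∝ (π/β)/Λ_n`.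

* §1 `klrm_integral_plane_radial` — `∫_{ℝ²} N(p₁²+p₂²) = π·∫_{s>0} N` (unconditional: polar coordinates + `s = r²`);
* §2 the clamped radius `min(k², r²)`, support and the `2rL`-Lipschitz bound of `k₀ ↦ N(k₀²+e²)`;
* §3 the frequency function `g(k₀) = ∫ N(k₀²+e²) de`: support, `4r²L`-Lipschitz, `∫ g = π∫_{s>0} N`;
* §4 **`klrm_matsubara_radial_le`**: `β⁻¹Σ_i g(ω_i) ≤ ½∫_{s>0}N + 4r²L(r + 2π/β)/β` (`M ≥ βr/(2π) + 1`);
* §5 **`klrm_ray_mass_norm_le`**: the per-ray sign-blind form with a complex insertion `‖W‖ ≤ B_W` and a complex integrand `‖H‖ ≤ N`;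
* §6 scale form on the slice shell `[(Λ_n/2)², (4Λ_n)²]` at `n ≤ n_β + 1` (`klrm_ray_mass_norm_le_scale`): error `≤ (1024/π)(4ℓ+16M)·(π/β)/Λ_n`.

Pure analysis; nothing about the model is asserted.  The planar (`× 2π` over the angle, Jacobian `≤ π√2/d`: `klry_*`, `klrj_*`) and lattice
(`klfl_matsubara_latticeAverage_norm_le_scale`) layers apply to these ray bounds verbatim as they do to `klsb2_*`.
-/

noncomputable section

namespace Summit.HubbardSuperconductivity.HubbardSuperconductivity.Theorems.KLRegimeSplit

set_option linter.dupNamespace false -- summit = problem name (single-conjunct summit), D-0017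

open Real Set MeasureTheory Complex Literature.MathematicalPhysics.QuantumLattice Literature.Probability.LatticeModels
open Summit.HubbardSuperconductivity.HubbardSuperconductivity.Theorems
open Summit.HubbardSuperconductivity.HubbardSuperconductivity.Theorems.KLProgrammeLegKernels

/-! ## §1 The polar identity for radial functions on the plane -/

/-- **`∫_{ℝ²} N(p₁² + p₂²) dp = π·∫_{s>0} N(s) ds`** for every `N : ℝ → ℝ` (polar coordinates, then `s = r²`; both sides are Mathlib's `0`
when non-integrable, so no hypothesis is needed). -/
theorem klrm_integral_plane_radial (N : ℝ → ℝ) : ∫ p : ℝ × ℝ, N (p.1 ^ 2 + p.2 ^ 2) = π * ∫ s in Ioi (0 : ℝ), N s := by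
  -- polar coordinates: `∫ = (∫_{r>0} r·N(r²)) · (∫_{θ ∈ (-π,π)} 1)`
  have h1 : ∫ p : ℝ × ℝ, N (p.1 ^ 2 + p.2 ^ 2) = (∫ r in Ioi (0 : ℝ), r * N (r ^ 2)) * ∫ _θ in Ioo (-π) π, (1 : ℝ) := by
    set fR : ℝ → ℝ := fun r => r * N (r ^ 2) with hfR
    set gθ : ℝ → ℝ := fun _ => 1 with hgθ
    rw [← integral_comp_polarCoord_symm, polarCoord_target]
    rw [show (fun p : ℝ × ℝ => p.1 • N ((polarCoord.symm p).1 ^ 2 + (polarCoord.symm p).2 ^ 2)) =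
        fun p : ℝ × ℝ => fR p.1 * gθ p.2 from ?_, Measure.volume_eq_prod, setIntegral_prod_mul]
    funext p
    simp only [hfR, hgθ, polarCoord_symm_apply, smul_eq_mul, klzs_polar_sq_add_sq, mul_one]
  have h2 : ∫ _θ in Ioo (-π) π, (1 : ℝ) = 2 * π := by
    rw [setIntegral_const, smul_eq_mul, mul_one, Measure.real, Real.volume_Ioo,
      ENNReal.toReal_ofReal (by linarith [Real.pi_pos])]
    ring
  have h3 : ∫ r in Ioi (0 : ℝ), r * N (r ^ 2) = 1 / 2 * ∫ s in Ioi (0 : ℝ), N s := by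
    have h := integral_comp_rpow_Ioi_of_pos (g := N) (p := 2) two_pos
    have h4 : ∫ x in Ioi (0 : ℝ), ((2 : ℝ) * x ^ ((2 : ℝ) - 1)) • N (x ^ (2 : ℝ)) = ∫ x in Ioi (0 : ℝ), 2 * (x * N (x ^ 2)) := by
      refine setIntegral_congr_fun measurableSet_Ioi fun x _ => ?_
      simp only [smul_eq_mul]
      rw [show (2 : ℝ) - 1 = 1 by norm_num, Real.rpow_one, Real.rpow_two]
      ring
    rw [h4, integral_const_mul] at h
    linarith
  rw [h1, h2, h3]
  ring

/-! ## §2 The clamped radius: support and Lipschitz in the frequency -/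

section Radial

variable {N : ℝ → ℝ} {L r : ℝ}

/-- `min(k², r²) = (min |k| r)²` for `r ≥ 0`. -/
theorem klrm_min_sq_eq (k : ℝ) (hr : 0 ≤ r) : min (k ^ 2) (r ^ 2) = (min |k| r) ^ 2 := by
  rcases le_total |k| r with h | h
  · rw [min_eq_left h, min_eq_left (by nlinarith [sq_abs k, abs_nonneg k]), sq_abs]
  · rw [min_eq_right h, min_eq_right (by nlinarith [sq_abs k, abs_nonneg k])]

/-- **The clamped radius is `2r`-Lipschitz**: `|min(k², r²) − min(k′², r²)| ≤ 2r·|k − k′|` (`r ≥ 0`). -/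
theorem klrm_abs_min_sq_sub_le (hr : 0 ≤ r) (k k' : ℝ) : |min (k ^ 2) (r ^ 2) - min (k' ^ 2) (r ^ 2)| ≤ 2 * r * |k - k'| := by
  rw [klrm_min_sq_eq k hr, klrm_min_sq_eq k' hr, sq_sub_sq, abs_mul]
  have h1 : |min |k| r + min |k'| r| ≤ 2 * r := by
    rw [abs_of_nonneg (add_nonneg (le_min (abs_nonneg _) hr) (le_min (abs_nonneg _) hr))]
    linarith [min_le_right |k| r, min_le_right |k'| r]
  have h2 : |min |k| r - min |k'| r| ≤ |k - k'| :=
    (abs_min_sub_min_le_max _ _ _ _).trans (by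
      rw [sub_self, abs_zero, max_eq_left (abs_nonneg _)]
      exact abs_abs_sub_abs_le_abs_sub k k')
  calc |min |k| r + min |k'| r| * |min |k| r - min |k'| r| ≤ 2 * r * |k - k'| :=
      mul_le_mul h1 h2 (abs_nonneg _) (by positivity)

/-- Clamping the frequency does not change a profile supported in `s < r²`: `N(k² + e²) = N(min(k², r²) + e²)`. -/
theorem klrm_radial_eq_clamp (hsupp : ∀ s, r ^ 2 ≤ s → N s = 0) (k e : ℝ) : N (k ^ 2 + e ^ 2) = N (min (k ^ 2) (r ^ 2) + e ^ 2) := by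
  rcases le_total (k ^ 2) (r ^ 2) with h | h
  · rw [min_eq_left h]
  · rw [min_eq_right h, hsupp _ (by nlinarith [sq_nonneg e]), hsupp _ (by nlinarith [sq_nonneg e])]

/-- Off the disc of radius `r` the profile vanishes: frequency direction … -/
theorem klrm_radial_zero_of_le_abs_fst (hsupp : ∀ s, r ^ 2 ≤ s → N s = 0) (hr : 0 ≤ r) {k : ℝ} (hk : r ≤ |k|) (e : ℝ) :
    N (k ^ 2 + e ^ 2) = 0 :=
  hsupp _ (by nlinarith [sq_abs k, sq_nonneg e, abs_nonneg k])

/-- … and energy direction. -/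
theorem klrm_radial_zero_of_le_abs_snd (hsupp : ∀ s, r ^ 2 ≤ s → N s = 0) (hr : 0 ≤ r) (k : ℝ) {e : ℝ} (he : r ≤ |e|) :
    N (k ^ 2 + e ^ 2) = 0 :=
  hsupp _ (by nlinarith [sq_abs e, sq_nonneg k, abs_nonneg e])

/-- **`k₀ ↦ N(k₀² + e²)` is `2rL`-Lipschitz**, uniformly in `e` (`N` `L`-Lipschitz with `L ≥ 0`, `N = 0` on `s ≥ r²`, `r ≥ 0`). -/
theorem klrm_radial_lipschitz_fst (hlip : ∀ s s', |N s - N s'| ≤ L * |s - s'|) (hL : 0 ≤ L) (hsupp : ∀ s, r ^ 2 ≤ s → N s = 0)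
    (hr : 0 ≤ r) (e k k' : ℝ) : |N (k ^ 2 + e ^ 2) - N (k' ^ 2 + e ^ 2)| ≤ 2 * r * L * |k - k'| := by
  rw [klrm_radial_eq_clamp hsupp k e, klrm_radial_eq_clamp hsupp k' e]
  refine (hlip _ _).trans ?_
  rw [add_sub_add_right_eq_sub]
  calc L * |min (k ^ 2) (r ^ 2) - min (k' ^ 2) (r ^ 2)| ≤ L * (2 * r * |k - k'|) :=
        mul_le_mul_of_nonneg_left (klrm_abs_min_sq_sub_le hr k k') hL
    _ = 2 * r * L * |k - k'| := by ring

/-- A Lipschitz profile is continuous. -/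
theorem klrm_continuous_of_lipschitz (hlip : ∀ s s', |N s - N s'| ≤ L * |s - s'|) (hL : 0 ≤ L) : Continuous N := by
  have hl : LipschitzWith (Real.toNNReal L) N := LipschitzWith.of_dist_le_mul fun t t' => by
    rw [Real.dist_eq, Real.dist_eq, Real.coe_toNNReal L hL]
    exact hlip t t'
  exact hl.continuous

/-- `p ↦ N(p₁² + p₂²)` is continuous on the plane. -/
theorem klrm_continuous_plane (hlip : ∀ s s', |N s - N s'| ≤ L * |s - s'|) (hL : 0 ≤ L) :
    Continuous fun p : ℝ × ℝ => N (p.1 ^ 2 + p.2 ^ 2) :=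
  (klrm_continuous_of_lipschitz hlip hL).comp (by continuity)

/-- `p ↦ N(p₁² + p₂²)` is integrable on the plane (continuous, supported in the closed sup-norm ball of radius `r`). -/
theorem klrm_integrable_plane (hlip : ∀ s s', |N s - N s'| ≤ L * |s - s'|) (hL : 0 ≤ L) (hsupp : ∀ s, r ^ 2 ≤ s → N s = 0)
    (hr : 0 ≤ r) : Integrable fun p : ℝ × ℝ => N (p.1 ^ 2 + p.2 ^ 2) := by
  refine (klrm_continuous_plane hlip hL).integrable_of_hasCompactSupport ?_
  refine HasCompactSupport.intro (isCompact_closedBall (0 : ℝ × ℝ) r) fun p hp => ?_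
  rw [Metric.mem_closedBall, dist_zero_right, Prod.norm_def, not_le] at hp
  simp only [Real.norm_eq_abs] at hp
  rcases lt_max_iff.mp hp with h1 | h1
  · exact klrm_radial_zero_of_le_abs_fst hsupp hr h1.le _
  · exact klrm_radial_zero_of_le_abs_snd hsupp hr _ h1.le

/-- Each frequency fibre `e ↦ N(k² + e²)` is integrable. -/
theorem klrm_integrable_fibre (hlip : ∀ s s', |N s - N s'| ≤ L * |s - s'|) (hL : 0 ≤ L) (hsupp : ∀ s, r ^ 2 ≤ s → N s = 0)
    (hr : 0 ≤ r) (k : ℝ) : Integrable fun e : ℝ => N (k ^ 2 + e ^ 2) := by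
  have hc : Continuous fun e : ℝ => N (k ^ 2 + e ^ 2) := (klrm_continuous_of_lipschitz hlip hL).comp (by continuity)
  refine hc.integrable_of_hasCompactSupport ?_
  refine HasCompactSupport.intro (isCompact_Icc (a := -r) (b := r)) fun e he => ?_
  exact klrm_radial_zero_of_le_abs_snd hsupp hr k (klsp_le_abs_of_not_mem_Icc he)

/-! ## §3 The frequency function `g(k₀) = ∫ N(k₀² + e²) de` -/

/-- `g(k₀) = 0` for `|k₀| ≥ r`. -/
theorem klrm_freqFn_zero (hsupp : ∀ s, r ^ 2 ≤ s → N s = 0) (hr : 0 ≤ r) {k : ℝ} (hk : r ≤ |k|) :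
    ∫ e : ℝ, N (k ^ 2 + e ^ 2) = 0 := by
  simp_rw [klrm_radial_zero_of_le_abs_fst hsupp hr hk]
  exact integral_zero _ _

/-- `|g(k₀)| ≤ 2r·M` when `|N| ≤ M`. -/
theorem klrm_abs_freqFn_le {M : ℝ} (hbd : ∀ s, |N s| ≤ M) (hsupp : ∀ s, r ^ 2 ≤ s → N s = 0) (hr : 0 ≤ r) (k : ℝ) :
    |∫ e : ℝ, N (k ^ 2 + e ^ 2)| ≤ 2 * r * M := by
  have h := klsp_norm_integral_slice_le (E := ℝ) (h := fun e : ℝ => N (k ^ 2 + e ^ 2)) hr (fun e => by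
    rw [Real.norm_eq_abs]; exact hbd _) (fun e he => klrm_radial_zero_of_le_abs_snd hsupp hr k he)
  rwa [Real.norm_eq_abs] at h

/-- **`g` is `4r²L`-Lipschitz.** -/
theorem klrm_freqFn_lipschitz (hlip : ∀ s s', |N s - N s'| ≤ L * |s - s'|) (hL : 0 ≤ L) (hsupp : ∀ s, r ^ 2 ≤ s → N s = 0)
    (hr : 0 ≤ r) (k k' : ℝ) :
    |(∫ e : ℝ, N (k ^ 2 + e ^ 2)) - ∫ e : ℝ, N (k' ^ 2 + e ^ 2)| ≤ 4 * r ^ 2 * L * |k - k'| := by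
  rw [← integral_sub (klrm_integrable_fibre hlip hL hsupp hr k) (klrm_integrable_fibre hlip hL hsupp hr k')]
  have h := klsp_norm_integral_slice_le (E := ℝ) (h := fun e : ℝ => N (k ^ 2 + e ^ 2) - N (k' ^ 2 + e ^ 2)) hr
    (B := 2 * r * L * |k - k'|) (fun e => by rw [Real.norm_eq_abs]; exact klrm_radial_lipschitz_fst hlip hL hsupp hr e k k')
    (fun e he => by rw [klrm_radial_zero_of_le_abs_snd hsupp hr k he, klrm_radial_zero_of_le_abs_snd hsupp hr k' he, sub_zero])
  rw [Real.norm_eq_abs] at h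
  refine h.trans (le_of_eq ?_)
  ring

/-- **`∫ g = π·∫_{s>0} N`** (Fubini + §1). -/
theorem klrm_integral_freqFn_eq (hlip : ∀ s s', |N s - N s'| ≤ L * |s - s'|) (hL : 0 ≤ L) (hsupp : ∀ s, r ^ 2 ≤ s → N s = 0)
    (hr : 0 ≤ r) : ∫ k : ℝ, ∫ e : ℝ, N (k ^ 2 + e ^ 2) = π * ∫ s in Ioi (0 : ℝ), N s := by
  have hI := klrm_integrable_plane hlip hL hsupp hr
  have h := integral_prod (μ := (volume : Measure ℝ)) (ν := (volume : Measure ℝ))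
    (f := fun p : ℝ × ℝ => N (p.1 ^ 2 + p.2 ^ 2)) (by rwa [← Measure.volume_eq_prod])
  simp only at h
  rw [← h, ← Measure.volume_eq_prod]
  exact klrm_integral_plane_radial N

/-! ## §4 The Matsubara form -/

/-- **Matsubara sum of a radial profile, sharp main term**: for `N` `L`-Lipschitz (`L ≥ 0`) with `N = 0` on `s ≥ r²` (`r > 0`), `β > 0`
and `M ≥ βr/(2π) + 1`:  `β⁻¹·Σ_{i : MatsubaraIdx M} ∫ N(ω_i² + e²) de ≤ ½·∫_{s>0} N(s) ds + 4r²L·(r + 2π/β)/β`. -/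
theorem klrm_matsubara_radial_le (hlip : ∀ s s', |N s - N s'| ≤ L * |s - s'|) (hL : 0 ≤ L) (hsupp : ∀ s, r ^ 2 ≤ s → N s = 0)
    (hr : 0 < r) {β : ℝ} (hβ : 0 < β) {M : ℕ} (hM : β * r / (2 * Real.pi) + 1 ≤ M) :
    β⁻¹ * ∑ i : MatsubaraIdx M, ∫ e : ℝ, N (matsubaraFreq β M i ^ 2 + e ^ 2) ≤
      1 / 2 * (∫ s in Ioi (0 : ℝ), N s) + 4 * r ^ 2 * L * (r + 2 * Real.pi / β) / β := by
  set g : ℝ → ℝ := fun k => ∫ e : ℝ, N (k ^ 2 + e ^ 2) with hg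
  have hD : (0 : ℝ) ≤ 4 * r ^ 2 * L := by positivity
  have hglip : ∀ t t', ‖g t - g t'‖ ≤ 4 * r ^ 2 * L * |t - t'| := fun t t' => by
    rw [Real.norm_eq_abs]; exact klrm_freqFn_lipschitz hlip hL hsupp hr.le t t'
  have hgsupp : ∀ t, r ≤ |t| → g t = 0 := fun t ht => klrm_freqFn_zero hsupp hr.le ht
  have h := klmr_matsubara_sum_sub_integral_norm_le (E := ℝ) hD hglip hr.le hgsupp hβ hM
  rw [Real.norm_eq_abs, smul_eq_mul, smul_eq_mul] at h
  have hint : (2 * Real.pi)⁻¹ * ∫ t, g t = 1 / 2 * ∫ s in Ioi (0 : ℝ), N s := by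
    rw [hg]
    simp only
    rw [klrm_integral_freqFn_eq hlip hL hsupp hr.le]
    field_simp
  have hsum : ∑ i : MatsubaraIdx M, ∫ e : ℝ, N (matsubaraFreq β M i ^ 2 + e ^ 2) = ∑ i : MatsubaraIdx M, g (matsubaraFreq β M i) :=
    rfl
  have h3 := sub_le_iff_le_add'.1 (abs_sub_le_iff.1 h).1
  rw [hint] at h3
  rw [hsum]
  exact h3

end Radial

/-! ## §5 Per ray: a complex insertion and a complex integrand under a real radial majorant -/

section Ray

variable {H : ℝ → ℂ} {W : ℝ → ℂ} {N : ℝ → ℝ} {L r BW : ℝ}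

/-- **The sharp sign-blind ray mass.**  For a complex radial integrand `H : ℝ → ℂ` dominated by a real profile, `‖H(s)‖ ≤ N(s)`, with `N`
`L`-Lipschitz (`L ≥ 0`) and `N = 0` on `s ≥ r²` (`r > 0`), an insertion `W` with `‖W(e)‖ ≤ B_W` (`B_W ≥ 0`) for `|e| < r`, `β > 0` and
`M ≥ βr/(2π) + 1`:  `‖β⁻¹ • Σ_i ∫ W(e)·H(ω_i² + e²) de‖ ≤ B_W·(½∫_{s>0} N(s) ds + 4r²L(r + 2π/β)/β)`. -/
theorem klrm_ray_mass_norm_le (hlip : ∀ s s', |N s - N s'| ≤ L * |s - s'|) (hL : 0 ≤ L) (hsupp : ∀ s, r ^ 2 ≤ s → N s = 0)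
    (hr : 0 < r) (hHN : ∀ s, ‖H s‖ ≤ N s) (hBW : 0 ≤ BW) (hW : ∀ e, |e| < r → ‖W e‖ ≤ BW) {β : ℝ} (hβ : 0 < β) {M : ℕ}
    (hM : β * r / (2 * Real.pi) + 1 ≤ M) :
    ‖β⁻¹ • ∑ i : MatsubaraIdx M, ∫ e : ℝ, W e * H (matsubaraFreq β M i ^ 2 + e ^ 2)‖ ≤
      BW * (1 / 2 * (∫ s in Ioi (0 : ℝ), N s) + 4 * r ^ 2 * L * (r + 2 * Real.pi / β) / β) := by
  -- each `e`-integral is bounded in norm by `B_W · g(ω_i)`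
  have hfib : ∀ k : ℝ, ‖∫ e : ℝ, W e * H (k ^ 2 + e ^ 2)‖ ≤ BW * ∫ e : ℝ, N (k ^ 2 + e ^ 2) := by
    intro k
    have hI : Integrable fun e : ℝ => BW * N (k ^ 2 + e ^ 2) := (klrm_integrable_fibre hlip hL hsupp hr.le k).const_mul BW
    refine (norm_integral_le_of_norm_le hI (Filter.Eventually.of_forall fun e => ?_)).trans (le_of_eq (integral_const_mul _ _))
    by_cases he : |e| < r
    · rw [norm_mul]
      exact mul_le_mul (hW e he) (hHN _) (norm_nonneg _) hBW
    · have hz : N (k ^ 2 + e ^ 2) = 0 := klrm_radial_zero_of_le_abs_snd hsupp hr.le k (not_lt.1 he)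
      have hH0 : H (k ^ 2 + e ^ 2) = 0 := norm_le_zero_iff.1 ((hHN _).trans hz.le)
      rw [hH0, mul_zero, norm_zero, hz, mul_zero]
  have hβinv : 0 ≤ β⁻¹ := inv_nonneg.2 hβ.le
  calc ‖β⁻¹ • ∑ i : MatsubaraIdx M, ∫ e : ℝ, W e * H (matsubaraFreq β M i ^ 2 + e ^ 2)‖
      ≤ β⁻¹ * ∑ i : MatsubaraIdx M, ‖∫ e : ℝ, W e * H (matsubaraFreq β M i ^ 2 + e ^ 2)‖ := by
        rw [norm_smul, Real.norm_of_nonneg hβinv]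
        exact mul_le_mul_of_nonneg_left (norm_sum_le _ _) hβinv
    _ ≤ β⁻¹ * ∑ i : MatsubaraIdx M, BW * ∫ e : ℝ, N (matsubaraFreq β M i ^ 2 + e ^ 2) :=
        mul_le_mul_of_nonneg_left (Finset.sum_le_sum fun i _ => hfib _) hβinv
    _ = BW * (β⁻¹ * ∑ i : MatsubaraIdx M, ∫ e : ℝ, N (matsubaraFreq β M i ^ 2 + e ^ 2)) := by
        rw [← Finset.mul_sum]; ring
    _ ≤ BW * (1 / 2 * (∫ s in Ioi (0 : ℝ), N s) + 4 * r ^ 2 * L * (r + 2 * Real.pi / β) / β) :=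
        mul_le_mul_of_nonneg_left (klrm_matsubara_radial_le hlip hL hsupp hr hβ hM) hBW

end Ray

/-! ## §6 Scale form on the slice shell -/

section Scale

variable {F : ℝ → ℂ} {W : ℝ → ℂ} {MF ℓ BW : ℝ}

/-- For a weight vanishing at `s ≤ 0`, `‖F(s)/s‖ = ‖F(s)‖/s` at every `s` (both sides are `0` for `s ≤ 0`). -/
theorem klrm_norm_div_coe_eq {F : ℝ → ℂ} (hF : ∀ s, s ≤ 0 → F s = 0) (s : ℝ) : ‖F s / ((s : ℝ) : ℂ)‖ = ‖F s‖ / s := by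
  rcases le_or_gt s 0 with h | h
  · rw [hF s h, zero_div, norm_zero, zero_div]
  · rw [norm_div, Complex.norm_real, Real.norm_of_nonneg h.le]

/-- **Scale form.**  At `n ≤ n_β + 1` (`β ≥ klBetaMin`), for a shell weight product `F` (`‖F‖ ≤ M_F`, `‖F(s) − F(s′)‖ ≤ (ℓ/Λ_n²)|s − s′|`,
`F = 0` for `s ≤ (Λ_n/2)²` and for `s ≥ (4Λ_n)²`) read as the radial integrand `F(s)/s`, an insertion `‖W(e)‖ ≤ B_W` on `|e| < 4Λ_n`,
and `M ≥ 4Λ_nβ/(2π) + 1`: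
`‖β⁻¹ • Σ_i ∫ W(e)·F(s)/s de‖ ≤ B_W·(½∫_{s>0}‖F(s)‖/s ds + (1024/π)(4ℓ + 16M_F)·(π/β)/Λ_n)`, `s = ω_i² + e²`. -/
theorem klrm_ray_mass_norm_le_scale (hbd : ∀ s, ‖F s‖ ≤ MF) {n : ℕ} (hlip : ∀ s s', ‖F s - F s'‖ ≤ ℓ / klScale klE0 n ^ 2 * |s - s'|)
    (hin : ∀ s, s ≤ (klScale klE0 n / 2) ^ 2 → F s = 0) (hout : ∀ s, (4 * klScale klE0 n) ^ 2 ≤ s → F s = 0)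
    (hBW : 0 ≤ BW) (hW : ∀ e, |e| < 4 * klScale klE0 n → ‖W e‖ ≤ BW)
    {β : ℝ} (hβ : klBetaMin ≤ β) (hn : n ≤ nScales β + 1) {M : ℕ} (hM : β * (4 * klScale klE0 n) / (2 * Real.pi) + 1 ≤ M) :
    ‖β⁻¹ • ∑ i : MatsubaraIdx M, ∫ e : ℝ,
        W e * (F (matsubaraFreq β M i ^ 2 + e ^ 2) / (((matsubaraFreq β M i ^ 2 + e ^ 2 : ℝ)) : ℂ))‖ ≤
      BW * (1 / 2 * (∫ s in Ioi (0 : ℝ), ‖F s‖ / s) + 1024 / Real.pi * (4 * ℓ + 16 * MF) * ((Real.pi / β) / klScale klE0 n)) := by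
  set Λ := klScale klE0 n with hΛdef
  have hΛ : 0 < Λ := klth_klScale_pos n
  have hβ0 : 0 < β := pos_of_klBetaMin_le hβ
  have hMF : 0 ≤ MF := (norm_nonneg _).trans (hbd 0)
  have hℓ : 0 ≤ ℓ := by
    have h := hlip 0 1
    have h0 : (0:ℝ) ≤ ‖F 0 - F 1‖ := norm_nonneg _
    norm_num at h
    by_contra hneg
    have : ℓ / Λ ^ 2 < 0 := div_neg_of_neg_of_pos (lt_of_not_ge hneg) (by positivity)
    linarith
  have hr₁ : 0 < Λ / 2 := by positivity
  have hr : 0 < 4 * Λ := by positivity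
  -- the real majorant profile `N = ‖F‖/s` and its Lipschitz constant (through `F/s`)
  set L := ℓ / Λ ^ 2 / (Λ / 2) ^ 2 + MF / (Λ / 2) ^ 4 with hLdef
  have hL : 0 ≤ L := by positivity
  have hF0 : ∀ s, s ≤ 0 → F s = 0 := fun s hs => hin s (hs.trans (sq_nonneg _))
  have hHlip : ∀ s s', ‖F s / ((s : ℝ) : ℂ) - F s' / ((s' : ℝ) : ℂ)‖ ≤ L * |s - s'| :=
    fun s s' => klsp_div_lipschitz hlip hbd hin hr₁ s s'
  have hNlip : ∀ s s', |‖F s‖ / s - ‖F s'‖ / s'| ≤ L * |s - s'| := fun s s' => by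
    rw [← klrm_norm_div_coe_eq hF0 s, ← klrm_norm_div_coe_eq hF0 s']
    exact (abs_norm_sub_norm_le _ _).trans (hHlip s s')
  have hNsupp : ∀ s, (4 * Λ) ^ 2 ≤ s → ‖F s‖ / s = 0 := fun s hs => by rw [hout s hs, norm_zero, zero_div]
  have hHN : ∀ s, ‖F s / ((s : ℝ) : ℂ)‖ ≤ ‖F s‖ / s := fun s => (klrm_norm_div_coe_eq hF0 s).le
  have hmain := klrm_ray_mass_norm_le (H := fun s => F s / ((s : ℝ) : ℂ)) (W := W) (N := fun s => ‖F s‖ / s)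
    hNlip hL hNsupp hr hHN hBW hW hβ0 hM
  suffices hE : 4 * (4 * Λ) ^ 2 * L * (4 * Λ + 2 * Real.pi / β) / β ≤ 1024 / Real.pi * (4 * ℓ + 16 * MF) * ((Real.pi / β) / Λ) from
    hmain.trans (mul_le_mul_of_nonneg_left (by linarith [hE]) hBW)
  -- the thermal error: `4(4Λ)²·L·(4Λ + 2π/β)/β ≤ (1024/π)(4ℓ+16M_F)·(π/β)/Λ`
  have hLval : 4 * (4 * Λ) ^ 2 * L = 64 * (4 * ℓ + 16 * MF) / Λ ^ 2 := by
    rw [hLdef]; field_simp; ring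
  have hcount := klsp_count_factor_le hβ hn
  rw [← hΛdef] at hcount
  have hstep : (4 * Λ + 2 * Real.pi / β) / β ≤ 16 * Λ * (Real.pi / β) / Real.pi := by
    have h1 : (4 * Λ + 2 * Real.pi / β) / β = (Real.pi / β) * (4 * Λ / Real.pi + 2 / β) := by
      field_simp
    rw [h1]
    have h2 : 4 * Λ / Real.pi + 2 / β ≤ 16 / Real.pi * Λ := by
      have : 2 / β ≤ 3 / β := div_le_div_of_nonneg_right (by norm_num) hβ0.le
      linarith
    calc Real.pi / β * (4 * Λ / Real.pi + 2 / β) ≤ Real.pi / β * (16 / Real.pi * Λ) :=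
          mul_le_mul_of_nonneg_left h2 (by positivity)
      _ = 16 * Λ * (Real.pi / β) / Real.pi := by field_simp
  calc 4 * (4 * Λ) ^ 2 * L * (4 * Λ + 2 * Real.pi / β) / β
      = (64 * (4 * ℓ + 16 * MF) / Λ ^ 2) * ((4 * Λ + 2 * Real.pi / β) / β) := by rw [← hLval]; ring
    _ ≤ (64 * (4 * ℓ + 16 * MF) / Λ ^ 2) * (16 * Λ * (Real.pi / β) / Real.pi) :=
        mul_le_mul_of_nonneg_left hstep (by positivity)
    _ = 1024 / Real.pi * (4 * ℓ + 16 * MF) * ((Real.pi / β) / Λ) := by field_simp; ring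

/-- **The thermal error in the ladder's currency**: `(1024/π)(4ℓ+16M_F)·(π/β)/Λ_n ≤ (4096/π)(4ℓ+16M_F)·4^{−(n_β−n)}` at `n ≤ n_β + 1`. -/
theorem klrm_thermal_error_le_inv_pow {ℓ MF : ℝ} (hℓ : 0 ≤ ℓ) (hMF : 0 ≤ MF) {β : ℝ} (hβ : klBetaMin ≤ β) {n : ℕ}
    (hn : n ≤ nScales β + 1) :
    1024 / Real.pi * (4 * ℓ + 16 * MF) * ((Real.pi / β) / klScale klE0 n) ≤
      4096 / Real.pi * (4 * ℓ + 16 * MF) * ((4 : ℝ) ^ (nScales β - n))⁻¹ := by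
  have h := klte_ratio_le_four_mul_inv_pow hβ hn
  have h0 : 0 ≤ 1024 / Real.pi * (4 * ℓ + 16 * MF) := by positivity
  calc 1024 / Real.pi * (4 * ℓ + 16 * MF) * ((Real.pi / β) / klScale klE0 n)
      ≤ 1024 / Real.pi * (4 * ℓ + 16 * MF) * (4 * ((4 : ℝ) ^ (nScales β - n))⁻¹) := mul_le_mul_of_nonneg_left h h0
    _ = 4096 / Real.pi * (4 * ℓ + 16 * MF) * ((4 : ℝ) ^ (nScales β - n))⁻¹ := by ring

end Scale

end Summit.HubbardSuperconductivity.HubbardSuperconductivity.Theorems.KLRegimeSplit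

end
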